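import Mathlib
import Literature.Analysis.FluidPDE.LatticeShearWords
import Literature.Analysis.FunctionSpaces.TorusEnstrophyOrthogonality
import Literature.Analysis.FunctionSpaces.TorusFourierCalculus
import Literature.Analysis.FunctionSpaces.TorusPeriodicLocalization
import Literature.Analysis.FunctionSpaces.TorusPeriodization
import Literature.Analysis.FunctionSpaces.TorusFluidGlueProofs
import Literature.Analysis.FunctionSpaces.TorusHolderBridge
import Literature.Analysis.FunctionSpaces.HolderInterpolation
import HarnessLib

/-!
# Lattice shear layers and word carriers: smoothness, size, Lipschitz and Hölder bounds, divergence
(route `AnomalousDissipation/SolenoidalFractalHomogenisation`, crux K3 = stmt-AnomalousDissipation-19073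
`PermissibleFractalCarrier`, towards the registered stub `stub_regular`; support seat ad-sawtooth-support g7)

Elementary API over the DEFINITIONS of `Literature.Analysis.FluidPDE.LatticeShear` (`LatticePhase.layer`,
`LatticeWord.trapezoid`, `LatticeWord.carrier`, `LatticeWord.cell`, `FractalCarrierData.level`), which the
definitions file deliberately leaves without lemmas:

* §1 the trapezoidal envelope takes values in `[0, 1]`, vanishes outside its slot and is continuous;
* §2 the Fourier character composed with the cell scaling: `e_m(n • x) = e_{n m}(x)` (unimodularity `‖e_m(x)‖ = 1` is the tree's `DiscreteSpectrum.norm_mFourier_apply`, re-derived inline by `simp`);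
* §3 one Kolmogorov layer rescaled to `n` cells, `x ↦ layer(n • x)`: smooth, `‖·‖ ≤ 1/(2π)`,
  `‖∂ⱼ ·‖ ≤ n`, divergence free (weakly);
(the word carriers and level fields follow in `…PermissibleFractalCarrierWords`).
-/

set_option linter.dupNamespace false

noncomputable section

namespace Summit.AnomalousDissipation.AnomalousDissipation.Theorems.SolenoidalFractalHomogenisation.PermissibleCarrier

open Set Filter Topology MeasureTheory Complex
open scoped InnerProductSpace ENNReal NNReal ContDiff
open Literature.Analysis Literature.Analysis.FunctionSpaces Literature.Analysis.FunctionSpaces.Torus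
open Literature.Analysis.FluidPDE Literature.Analysis.FluidPDE.LatticeShear

/-! ## §1 The trapezoidal envelope -/

section Trapezoid

/-- The envelope is nonnegative. [folklore] -/
theorem trapezoid_nonneg (a τ ρ s : ℝ) : 0 ≤ LatticeWord.trapezoid a τ ρ s :=
  le_max_left _ _

/-- The envelope is at most `1`. [folklore] -/
theorem trapezoid_le_one (a τ ρ s : ℝ) : LatticeWord.trapezoid a τ ρ s ≤ 1 :=
  max_le zero_le_one (min_le_left _ _)

/-- `|trapezoid| ≤ 1`. [folklore] -/
theorem abs_trapezoid_le_one (a τ ρ s : ℝ) : |LatticeWord.trapezoid a τ ρ s| ≤ 1 := by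
  rw [abs_of_nonneg (trapezoid_nonneg a τ ρ s)]
  exact trapezoid_le_one a τ ρ s

/-- The envelope vanishes before its slot. [folklore] -/
theorem trapezoid_eq_zero_of_le {a τ ρ s : ℝ} (hρτ : 0 < ρ * τ) (hs : s ≤ a) :
    LatticeWord.trapezoid a τ ρ s = 0 := by
  unfold LatticeWord.trapezoid
  refine max_eq_left ?_
  have h1 : (s - a) / (ρ * τ) ≤ 0 := div_nonpos_of_nonpos_of_nonneg (by linarith) hρτ.le
  exact (min_le_right _ _).trans ((min_le_left _ _).trans h1)

/-- The envelope vanishes after its slot. [folklore] -/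
theorem trapezoid_eq_zero_of_ge {a τ ρ s : ℝ} (hρτ : 0 < ρ * τ) (hs : a + τ ≤ s) :
    LatticeWord.trapezoid a τ ρ s = 0 := by
  unfold LatticeWord.trapezoid
  refine max_eq_left ?_
  have h1 : (a + τ - s) / (ρ * τ) ≤ 0 := div_nonpos_of_nonpos_of_nonneg (by linarith) hρτ.le
  exact (min_le_right _ _).trans ((min_le_right _ _).trans h1)

/-- The envelope is continuous in time. [folklore] -/
theorem continuous_trapezoid (a τ ρ : ℝ) : Continuous fun s => LatticeWord.trapezoid a τ ρ s := by
  unfold LatticeWord.trapezoid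
  fun_prop

end Trapezoid

/-! ## §2 Characters and the cell scaling -/

section Character

variable {d : Type*} [Fintype d]

/-- `fourier k (n • y) = fourier (k n) y` on the unit circle. [folklore] -/
theorem fourier_nsmul (k : ℤ) (n : ℕ) (y : UnitAddCircle) :
    fourier k (n • y) = fourier (k * n) y := by
  induction y using QuotientAddGroup.induction_on with
  | H t =>
    have e1 : (n • (t : UnitAddCircle) : UnitAddCircle) = (((n : ℝ) * t : ℝ) : UnitAddCircle) := by
      rw [← AddCircle.coe_nsmul, nsmul_eq_mul]
    change fourier k (n • (t : UnitAddCircle)) = fourier (k * n) (t : UnitAddCircle)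
    rw [e1, fourier_coe_apply, fourier_coe_apply]
    push_cast
    ring_nf

/-- `e_m(n • x) = e_{n m}(x)` on `T^d`. [folklore] -/
theorem mFourier_nsmul (m : d → ℤ) (n : ℕ) (x : UnitAddTorus d) :
    UnitAddTorus.mFourier m (n • x) = UnitAddTorus.mFourier (fun i => m i * n) x := by
  simp only [UnitAddTorus.mFourier, ContinuousMap.coe_mk, Pi.smul_apply, fourier_nsmul]

end Character

/-! ## §3 One rescaled layer -/

section Layer

/-- A scalar read-out bound: `‖(Im (z e^{iφ}) / (2π|m|)) ê‖ ≤ ‖z‖/(2π|m|)` (`‖ê‖ = 1`). [folklore] -/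
theorem norm_readout_le (P : LatticePhase) (z : ℂ) :
    ‖((z * Complex.exp (P.φ * I)).im / (2 * Real.pi * ‖latticeVec P.m‖)) • P.e‖ ≤
      ‖z‖ / (2 * Real.pi * ‖latticeVec P.m‖) := by
  rw [norm_smul, P.e_unit, mul_one, Real.norm_eq_abs, abs_div,
    abs_of_pos (by have := one_le_norm_latticeVec P.m_ne; positivity : 0 < 2 * Real.pi * ‖latticeVec P.m‖)]
  refine div_le_div_of_nonneg_right ?_ (by positivity)
  calc |(z * Complex.exp (P.φ * I)).im| ≤ ‖z * Complex.exp (P.φ * I)‖ := Complex.abs_im_le_norm _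
    _ = ‖z‖ := by rw [norm_mul, Complex.norm_exp_ofReal_mul_I, mul_one]

/-- The rescaled layer through the character `e_{n m}`. [folklore] -/
theorem layer_nsmul_eq (P : LatticePhase) (n : ℕ) (x : UnitAddTorus (Fin 3)) :
    P.layer (n • x) = ((UnitAddTorus.mFourier (fun i => P.m i * n) x * Complex.exp (P.φ * I)).im /
      (2 * Real.pi * ‖latticeVec P.m‖)) • P.e := by
  rw [LatticePhase.layer, mFourier_nsmul]

/-- The rescaled layer is a fixed real-linear read-out of the character `e_{n m}` (used for smoothness and
partial derivatives). [folklore] -/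
theorem exists_clm_layer_nsmul (P : LatticePhase) (n : ℕ) :
    ∃ L : ℂ →L[ℝ] EuclideanSpace ℝ (Fin 3),
      (∀ z, L z = ((z * Complex.exp (P.φ * I)).im / (2 * Real.pi * ‖latticeVec P.m‖)) • P.e) ∧
      (fun x : UnitAddTorus (Fin 3) => P.layer (n • x)) =
        L ∘ (⇑(UnitAddTorus.mFourier (fun i => P.m i * n)) : UnitAddTorus (Fin 3) → ℂ) := by
  refine ⟨((1 / (2 * Real.pi * ‖latticeVec P.m‖)) •
    (Complex.imCLM.comp (ContinuousLinearMap.mulLeftRight ℝ ℂ 1 (Complex.exp (P.φ * I))))).smulRight P.e, ?_, ?_⟩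
  · intro z
    simp [div_eq_inv_mul]
  · funext x
    rw [layer_nsmul_eq]
    simp [div_eq_inv_mul]

/-- The rescaled layer is smooth. [folklore] -/
theorem isSmooth_layer_nsmul (P : LatticePhase) (n : ℕ) :
    IsSmooth fun x : UnitAddTorus (Fin 3) => P.layer (n • x) := by
  obtain ⟨L, -, hcomp⟩ := exists_clm_layer_nsmul P n
  rw [hcomp]
  exact (isSmooth_mFourier _).comp_clm L

/-- `‖layer(n • x)‖ ≤ 1/(2π|m|) ≤ 1/(2π)`. [cite: MeshalkinSinai1961, pp. 1700–1705 (Kolmogorov shear layer)] -/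
theorem norm_layer_nsmul_le (P : LatticePhase) (n : ℕ) (x : UnitAddTorus (Fin 3)) :
    ‖P.layer (n • x)‖ ≤ 1 / (2 * Real.pi) := by
  rw [layer_nsmul_eq]
  refine (norm_readout_le P _).trans ?_
  rw [(by simp only [UnitAddTorus.mFourier, ContinuousMap.coe_mk, norm_prod, fourier_apply, Circle.norm_coe, Finset.prod_const_one] : ‖UnitAddTorus.mFourier (fun i => P.m i * (n : ℤ)) x‖ = 1)]
  have h1 := one_le_norm_latticeVec P.m_ne
  exact div_le_div_of_nonneg_left zero_le_one (by positivity) (by nlinarith [Real.pi_pos])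

/-- **Partial derivatives of the rescaled layer**: `∂ⱼ layer(n • ·)(x) = (Im (2πi mⱼ n e_{nm}(x) e^{iφ})/(2π|m|)) ê`.
[folklore] -/
theorem partialDeriv_layer_nsmul (P : LatticePhase) (n : ℕ) (j : Fin 3) (x : UnitAddTorus (Fin 3)) :
    Torus.partialDeriv j (fun y : UnitAddTorus (Fin 3) => P.layer (n • y)) x =
      ((2 * Real.pi * I * ((P.m j * n : ℤ) : ℂ) * UnitAddTorus.mFourier (fun i => P.m i * n) x *
          Complex.exp (P.φ * I)).im / (2 * Real.pi * ‖latticeVec P.m‖)) • P.e := by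
  obtain ⟨L, hL, hcomp⟩ := exists_clm_layer_nsmul P n
  rw [hcomp, partialDeriv_clm_comp (isSmooth_mFourier _) L j x, partialDeriv_mFourier, hL]

/-- `‖∂ⱼ layer(n • ·)(x)‖ ≤ n |mⱼ|/|m| ≤ n` (unit maximal shear rate, `n` cells). [folklore] -/
theorem norm_partialDeriv_layer_nsmul_le (P : LatticePhase) (n : ℕ) (j : Fin 3) (x : UnitAddTorus (Fin 3)) :
    ‖Torus.partialDeriv j (fun y : UnitAddTorus (Fin 3) => P.layer (n • y)) x‖ ≤ n := by
  rw [partialDeriv_layer_nsmul]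
  refine (norm_readout_le P _).trans ?_
  have hK : 0 < 2 * Real.pi * ‖latticeVec P.m‖ := by have := one_le_norm_latticeVec P.m_ne; positivity
  rw [div_le_iff₀ hK, norm_mul, (by simp only [UnitAddTorus.mFourier, ContinuousMap.coe_mk, norm_prod, fourier_apply, Circle.norm_coe, Finset.prod_const_one] : ‖UnitAddTorus.mFourier (fun i => P.m i * (n : ℤ)) x‖ = 1), mul_one]
  simp only [norm_mul, Complex.norm_real, Complex.norm_I, Real.norm_eq_abs, mul_one,
    Complex.norm_ofNat, Int.cast_mul, Int.cast_natCast, Complex.norm_natCast, Complex.norm_intCast]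
  rw [abs_of_pos Real.pi_pos]
  have h1 : |(P.m j : ℝ)| ≤ ‖latticeVec P.m‖ := abs_le_norm_latticeVec P.m j
  have hn : (0 : ℝ) ≤ n := Nat.cast_nonneg n
  nlinarith [Real.pi_pos, mul_le_mul_of_nonneg_left h1 hn]

/-- The rescaled layer is (classically) divergence free: `ê ⊥ m`. [cite: MeshalkinSinai1961, pp. 1700–1705] -/
theorem isDivFree_layer_nsmul (P : LatticePhase) (n : ℕ) :
    IsDivFree fun x : UnitAddTorus (Fin 3) => P.layer (n • x) := by
  intro x
  have hs := isSmooth_layer_nsmul P n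
  rw [divergence_eq_sum_partialDeriv_apply (hs.isContDiff (by simp))]
  simp_rw [partialDeriv_layer_nsmul, PiLp.smul_apply, smul_eq_mul]
  -- `∑ⱼ cⱼ eⱼ` with `cⱼ = c · mⱼ`: factor and use `ê ⊥ m`
  have hperp : ∑ j : Fin 3, (P.m j : ℝ) * P.e j = 0 := by
    have h := P.e_perp
    rw [EuclideanSpace.inner_eq_star_dotProduct] at h
    simpa [dotProduct, latticeVec_apply, mul_comm] using h
  have key : ∀ j : Fin 3,
      (2 * ↑Real.pi * I * ((P.m j * n : ℤ) : ℂ) * UnitAddTorus.mFourier (fun i => P.m i * ↑n) x *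
            Complex.exp (↑P.φ * I)).im / (2 * Real.pi * ‖latticeVec P.m‖) * P.e j =
        ((2 * ↑Real.pi * I * (n : ℂ) * UnitAddTorus.mFourier (fun i => P.m i * ↑n) x * Complex.exp (↑P.φ * I)).im /
            (2 * Real.pi * ‖latticeVec P.m‖)) * ((P.m j : ℝ) * P.e j) := by
    intro j
    have e1 : (2 * ↑Real.pi * I * ((P.m j * n : ℤ) : ℂ) * UnitAddTorus.mFourier (fun i => P.m i * ↑n) x *
        Complex.exp (↑P.φ * I)) = ((P.m j : ℝ) : ℂ) *
        (2 * ↑Real.pi * I * (n : ℂ) * UnitAddTorus.mFourier (fun i => P.m i * ↑n) x * Complex.exp (↑P.φ * I)) := by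
      push_cast; ring
    rw [e1, Complex.im_ofReal_mul]
    ring
  simp_rw [key, ← Finset.mul_sum, hperp, mul_zero]

/-- The rescaled layer is weakly divergence free. [folklore] -/
theorem isWeaklyDivFree_layer_nsmul (P : LatticePhase) (n : ℕ) :
    IsWeaklyDivFree fun x : UnitAddTorus (Fin 3) => P.layer (n • x) :=
  (isDivFree_layer_nsmul P n).isWeaklyDivFree_holds (isSmooth_layer_nsmul P n)

end Layer

end Summit.AnomalousDissipation.AnomalousDissipation.Theorems.SolenoidalFractalHomogenisation.PermissibleCarrier

end
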